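import Summits.Ventures.HSemireg.WedgeHankelRecurrenceCensusDet

/-!
# Venture HSemireg — THE CATALECTICANT OF A SUM OF GEOMETRIC SEQUENCES (Sylvester): for `t + 1` nodes `λ_i` with weights `A_i`, the square Hankel matrix of `q_j = Σ_i A_i λ_i^j` factors as
# **`(q_{i+j})_{i,j ≤ t} = Vᵀ · diag(A) · V`**, `V` the Vandermonde matrix of the nodes, so **`det = (∏_i A_i) · (∏_{i<j} (λ_j − λ_i))²`** — non-zero iff the weights are non-zero and the nodes distinct;
# with fewer than `t + 1` terms the determinant vanishes

HONEST FRAMING. Part of the Lean index of the computation cell `pub-hsemireg` (seat p10 gen 30, Sunday typer «UNIFORM-IN-n»).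
LINEAR ALGEBRA OF HANKEL (catalecticant) MATRICES and of polynomials over a field ONLY: no variety, no cohomology theory, no sheaf, no Ext group and no semiregularity map is constructed
here; nothing here says that HC / HC_CM / HC_AV holds; no Literature fact is declared or used.  Custodian versions as in `WedgeHankelSiegelIdeal` (1/3); the dictionary («the catalecticant of a
sum of `t + 1` `N`-th powers of linear forms is the product of the coefficients times the square of the product of differences of the roots», Sylvester 1851) is QUOTED in docstrings, never
asserted.

WHAT IS IN THE TREE.  N48 (`WedgeHankelRecurrenceCensusDet`, № 330): `hankelSq` (`(q_{i+j})_{i,j ≤ t}`), `rank_hankelSq`, `rank_hankelSq_eq_iff_det_ne_zero`; `WedgeHankelSecantRank` (tree): `secSeq`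
(`secSeq A λ j = Σ_i A_i λ_i^j`), `rank_hankel1_secSeq_le` (`rank ≤` number of terms).  Mathlib: `Matrix.vandermonde`, `Matrix.det_vandermonde` (`∏_i ∏_{j>i} (v_j − v_i)`),
`Matrix.det_vandermonde_ne_zero_iff`, `Matrix.det_mul`, `Matrix.det_transpose`, `Matrix.det_diagonal`, `Finset.prod_ne_zero_iff`.
THIS FILE (namespace `Summit.Ventures.HSemireg.Wedge.HankelOuter` continued; PLAIN on N48; 0 definitions):
* §635 **`hankelSq_secSeq_eq`** (`t + 1` nodes: `hankelSq t (secSeq A λ) = (vandermonde λ)ᵀ · diagonal A · vandermonde λ`), **`det_hankelSq_secSeq`** (`= (∏ A_i) · det(V)²`),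
  **`det_hankelSq_secSeq_eq_prod`** (`= (∏ A_i) · (∏_i ∏_{j>i} (λ_j − λ_i))²`), **`det_hankelSq_secSeq_ne_zero_iff`** (`≠ 0 ↔ (∀ i, A_i ≠ 0) ∧ λ injective`),
  `det_hankelSq_secSeq_eq_zero_of_lt` (fewer than `t + 1` terms ⇒ `det = 0`).
Nothing Ext-side.  New names only.
-/

open Module Polynomial
open scoped Matrix Polynomial

namespace Summit.Ventures.HSemireg.Wedge.HankelOuter

open Summit.Ventures.HSemireg.Wedge Summit.Ventures.HSemireg.Wedge.Hankel Summit.Ventures.HSemireg.Wedge.HankelSecant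

variable (K : Type*) [Field K]

/-! ## §635. The catalecticant of a sum of `t + 1` geometric sequences -/

/-- **`(q_{i+j})_{i,j ≤ t} = Vᵀ · diag(A) · V`** for `q = secSeq A λ` with `t + 1` nodes, `V_{kl} = λ_k^l` the Vandermonde matrix: `q_{i+j} = Σ_k λ_k^i · A_k · λ_k^j`. -/
theorem hankelSq_secSeq_eq {t : ℕ} (A lam : Fin (t + 1) → K) :
    hankelSq K t (secSeq K A lam) = (Matrix.vandermonde lam)ᵀ * Matrix.diagonal A * Matrix.vandermonde lam := by
  ext i j
  rw [Matrix.mul_assoc, Matrix.mul_apply]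
  simp only [hankelSq, Matrix.of_apply, secSeq, Matrix.transpose_apply, Matrix.vandermonde_apply, Matrix.diagonal_mul, pow_add]
  exact Finset.sum_congr rfl fun k _ => by ring

/-- **`det (q_{i+j})_{i,j ≤ t} = (∏_i A_i) · det(V)²`.** -/
theorem det_hankelSq_secSeq {t : ℕ} (A lam : Fin (t + 1) → K) :
    (hankelSq K t (secSeq K A lam)).det = (∏ i, A i) * (Matrix.vandermonde lam).det ^ 2 := by
  rw [hankelSq_secSeq_eq, Matrix.det_mul, Matrix.det_mul, Matrix.det_transpose, Matrix.det_diagonal]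
  ring

/-- **SYLVESTER'S CATALECTICANT FORMULA: `det (q_{i+j})_{i,j ≤ t} = (∏_i A_i) · (∏_i ∏_{j>i} (λ_j − λ_i))²`.** -/
theorem det_hankelSq_secSeq_eq_prod {t : ℕ} (A lam : Fin (t + 1) → K) :
    (hankelSq K t (secSeq K A lam)).det = (∏ i, A i) * (∏ i : Fin (t + 1), ∏ j ∈ Finset.Ioi i, (lam j - lam i)) ^ 2 := by
  rw [det_hankelSq_secSeq, Matrix.det_vandermonde]

/-- **`det ≠ 0 ⟺ all weights are non-zero and the nodes are distinct.`** -/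
theorem det_hankelSq_secSeq_ne_zero_iff {t : ℕ} (A lam : Fin (t + 1) → K) :
    (hankelSq K t (secSeq K A lam)).det ≠ 0 ↔ (∀ i, A i ≠ 0) ∧ Function.Injective lam := by
  rw [det_hankelSq_secSeq, mul_ne_zero_iff, pow_ne_zero_iff two_ne_zero, Matrix.det_vandermonde_ne_zero_iff, Finset.prod_ne_zero_iff]
  simp only [Finset.mem_univ, true_imp_iff]

/-- **FEWER THAN `t + 1` TERMS ⇒ THE CATALECTICANT VANISHES** (`rank ≤ r < t + 1`). -/
theorem det_hankelSq_secSeq_eq_zero_of_lt {t r : ℕ} (hr : r < t + 1) (A lam : Fin r → K) : (hankelSq K t (secSeq K A lam)).det = 0 := by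
  by_contra h
  have hrank := (rank_hankelSq_eq_iff_det_ne_zero K t _).mpr h
  rw [rank_hankelSq] at hrank
  have hle := rank_hankel1_secSeq_le (K := K) (2 * t) (2 * t / 2) A lam
  omega

end Summit.Ventures.HSemireg.Wedge.HankelOuter
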